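import Mathlib
import HarnessLib
import Summits.HubbardSuperconductivity.HubbardSuperconductivity.Theorems.KLProgrammeKLRegimeEngineV17F2ClosersVGQDoors

/-!
# K3 ENGINE (stmt-HubbardSuperconductivity-20437 `KLRegimeEngineV17F2`, V2 registration 27cd7ed0f55f17c0), row (c) `stub_engine_step_values`:
# producer-side DOORS for the PIN rows of the (E4)-dressed split in the (c)-OUT package (γ/δ): canonical zero-frequency pins, sup + joint Lipschitz ⇒ the eight pin rows
# (cell gate-hubbard-kl, seat hubbard-kl-k3c2-p2 g25; companion of `…ClosersVGQOutD` p718126 / `…ClosersVGQSizeFits` p717608)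

WHY.  In `hexOutPkgγ/δ` (`rowC_hexOut_of_pkgγ/δ`) the producer of the «(E4)-DRESSED-SPLIT» hands, besides the split identities `hsplit/hsplitX` and the two
flatness rows, EIGHT pin rows about frequency-free pins `F₁₀`, `Fx₁₀` of the band-scale parts `F₁`, `Fx₁`: sups `≤ A₁` and Lipschitz constants `L₁` along the two
diagonals `k ↦ (k, k + (x−y))`, `k ↦ (k − (x−y), k)` (direct) and `k ↦ (k, k + (Qm−x−y))`, `k ↦ (k − (Qm−x−y), k)` (crossed).  With the CANONICAL pins
`F₁₀ t k σ k' := F₁ t (ω₀,k) σ (ω₀,k')`, `Fx₁₀ t k k' := Fx₁ t (ω₀,k) (ω₀.rev,k')` (the crossed base pair `(ω₀, ω₀.rev)` lies in the flatness window: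
`matsubaraInt ω₀.rev + 1 = matsubaraInt ω₀`) the eight rows follow from TWO primitive facts per part — a pointwise sup `a` and a JOINT torus-Lipschitz constant `ℓ`
at the base frequencies — with `A₁ := 2a`, `L₁ := 4ℓ`; the flatness rows then read `‖F₁ t (i,k) σ (i,k') − F₁ t (ω₀,k) σ (ω₀,k')‖ ≤ ε₁` etc. (producer's, unchanged).
* **`rowC_directPins_of_sup_lipschitz`** (the four direct pin rows), **`rowC_crossedPins_of_sup_lipschitz`** (the four crossed pin rows),
  `rowC_crossedPin_window` (`matsubaraInt M (omega0 M).rev + 1 = matsubaraInt M (omega0 M)`).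
Generic bookkeeping (norms of two-term sums, translation invariance of the torus norm); nothing here asserts any row of the package, (c), K3 or superconductivity.  0 kit · 0 lit.
-/

namespace Summit.HubbardSuperconductivity.HubbardSuperconductivity.Theorems.EngineV8

set_option linter.dupNamespace false -- summit = problem name (single-conjunct summit), D-0017

noncomputable section

open Real Set Finset Literature.MathematicalPhysics.QuantumLattice
open Literature.Probability.LatticeModels hiding torusSupNorm
open Summit.HubbardSuperconductivity.HubbardSuperconductivity.Theorems.KLProgrammeLegKernels
open Summit.HubbardSuperconductivity.HubbardSuperconductivity.Theorems.KLRegimeSplit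

variable {L M : ℕ} [NeZero M]

/-- The crossed base pair `(ω₀, ω₀.rev)` satisfies the window relation of `hflatX₁`: `matsubaraInt ω₀.rev + 1 = matsubaraInt ω₀`. -/
theorem rowC_crossedPin_window : matsubaraInt M (omega0 M).rev + 1 = matsubaraInt M (omega0 M) := by
  rw [matsubaraInt_rev, matsubaraInt_omega0]; ring

/-- Norm of a two-spin sum. -/
private theorem norm_sum_fin_two_le {f : Fin 2 → ℂ} {a : ℝ} (h : ∀ σ, ‖f σ‖ ≤ a) : ‖∑ σ : Fin 2, f σ‖ ≤ 2 * a := by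
  rw [Fin.sum_univ_two]
  exact (norm_add_le _ _).trans (by linarith [h 0, h 1])

/-- Translation invariance of torus-norm differences along a diagonal. -/
private theorem klTorusNorm_add_sub_add (k k' d : TorusSite 2 L) : klTorusNorm L (k + d - (k' + d)) = klTorusNorm L (k - k') := by
  rw [add_sub_add_right_eq_sub]

/-- **THE FOUR DIRECT PIN ROWS FROM SUP + JOINT LIPSCHITZ** (canonical pin `F₁₀ t k σ k' = F₁ t (ω₀,k) σ (ω₀,k')`): with `A₁ := 2a`, `L₁ := 4ℓ` the rows
`hY0p₁ hY1p₁ hY0m₁ hY1m₁` of `hexOutPkgγ/δ` in their literal shapes. -/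
theorem rowC_directPins_of_sup_lipschitz (x y : TorusSite 2 L) {a ℓ : ℝ}
    (F₁ : ℝ → FreqMomentum L M → Fin 2 → FreqMomentum L M → ℂ) (F₁₀ : ℝ → TorusSite 2 L → Fin 2 → TorusSite 2 L → ℂ)
    (hF₁₀ : F₁₀ = fun t k σ k' => F₁ t (omega0 M, k) σ (omega0 M, k'))
    (hsup : ∀ t ∈ Icc (0 : ℝ) 1, ∀ (p : FreqMomentum L M) (σ : Fin 2) (p' : FreqMomentum L M), ‖F₁ t p σ p'‖ ≤ a)
    (hlip : ∀ t ∈ Icc (0 : ℝ) 1, ∀ (σ : Fin 2) (k k' l l' : TorusSite 2 L),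
      ‖F₁ t (omega0 M, k) σ (omega0 M, k') - F₁ t (omega0 M, l) σ (omega0 M, l')‖ ≤ ℓ * (klTorusNorm L (k - l) + klTorusNorm L (k' - l'))) :
    (∀ t ∈ Icc (0 : ℝ) 1, ∀ k : TorusSite 2 L, ‖∑ σ : Fin 2, F₁₀ t k σ (k + (x - y))‖ ≤ 2 * a) ∧
    (∀ t ∈ Icc (0 : ℝ) 1, ∀ k k' : TorusSite 2 L, ‖(∑ σ : Fin 2, F₁₀ t k σ (k + (x - y))) - ∑ σ : Fin 2, F₁₀ t k' σ (k' + (x - y))‖ ≤ 4 * ℓ * klTorusNorm L (k - k')) ∧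
    (∀ t ∈ Icc (0 : ℝ) 1, ∀ k : TorusSite 2 L, ‖∑ σ : Fin 2, F₁₀ t (k + -(x - y)) σ k‖ ≤ 2 * a) ∧
    (∀ t ∈ Icc (0 : ℝ) 1, ∀ k k' : TorusSite 2 L, ‖(∑ σ : Fin 2, F₁₀ t (k + -(x - y)) σ k) - ∑ σ : Fin 2, F₁₀ t (k' + -(x - y)) σ k'‖ ≤ 4 * ℓ * klTorusNorm L (k - k')) := by
  subst hF₁₀
  refine ⟨fun t ht k => norm_sum_fin_two_le fun σ => hsup t ht _ _ _, fun t ht k k' => ?_,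
    fun t ht k => norm_sum_fin_two_le fun σ => hsup t ht _ _ _, fun t ht k k' => ?_⟩
  · rw [← Finset.sum_sub_distrib]
    have h := fun σ : Fin 2 => hlip t ht σ k (k + (x - y)) k' (k' + (x - y))
    simp only [klTorusNorm_add_sub_add] at h
    calc ‖∑ σ : Fin 2, (F₁ t (omega0 M, k) σ (omega0 M, k + (x - y)) - F₁ t (omega0 M, k') σ (omega0 M, k' + (x - y)))‖
        ≤ 2 * (ℓ * (klTorusNorm L (k - k') + klTorusNorm L (k - k'))) := norm_sum_fin_two_le h
      _ = 4 * ℓ * klTorusNorm L (k - k') := by ring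
  · rw [← Finset.sum_sub_distrib]
    have h := fun σ : Fin 2 => hlip t ht σ (k + -(x - y)) k (k' + -(x - y)) k'
    simp only [klTorusNorm_add_sub_add] at h
    calc ‖∑ σ : Fin 2, (F₁ t (omega0 M, k + -(x - y)) σ (omega0 M, k) - F₁ t (omega0 M, k' + -(x - y)) σ (omega0 M, k'))‖
        ≤ 2 * (ℓ * (klTorusNorm L (k - k') + klTorusNorm L (k - k'))) := norm_sum_fin_two_le h
      _ = 4 * ℓ * klTorusNorm L (k - k') := by ring

/-- **THE FOUR CROSSED PIN ROWS FROM SUP + JOINT LIPSCHITZ** (canonical pin `Fx₁₀ t k k' = Fx₁ t (ω₀,k) (ω₀.rev,k')`): with `A₁ := 2a`, `L₁ := 4ℓ` the rows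
`hY0B₁ hY1B₁ hY0A₁ hY1A₁` of `hexOutPkgγ/δ` in their literal shapes (`q := Qm − x − y`). -/
theorem rowC_crossedPins_of_sup_lipschitz (q : TorusSite 2 L) {a ℓ : ℝ} (ha : 0 ≤ a) (hℓ : 0 ≤ ℓ)
    (Fx₁ : ℝ → FreqMomentum L M → FreqMomentum L M → ℂ) (Fx₁₀ : ℝ → TorusSite 2 L → TorusSite 2 L → ℂ)
    (hFx₁₀ : Fx₁₀ = fun t k k' => Fx₁ t (omega0 M, k) ((omega0 M).rev, k'))
    (hsup : ∀ t ∈ Icc (0 : ℝ) 1, ∀ (p p' : FreqMomentum L M), ‖Fx₁ t p p'‖ ≤ a)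
    (hlip : ∀ t ∈ Icc (0 : ℝ) 1, ∀ (k k' l l' : TorusSite 2 L),
      ‖Fx₁ t (omega0 M, k) ((omega0 M).rev, k') - Fx₁ t (omega0 M, l) ((omega0 M).rev, l')‖ ≤ ℓ * (klTorusNorm L (k - l) + klTorusNorm L (k' - l'))) :
    (∀ t ∈ Icc (0 : ℝ) 1, ∀ k : TorusSite 2 L, ‖Fx₁₀ t k (k + q)‖ ≤ 2 * a) ∧
    (∀ t ∈ Icc (0 : ℝ) 1, ∀ k k' : TorusSite 2 L, ‖Fx₁₀ t k (k + q) - Fx₁₀ t k' (k' + q)‖ ≤ 4 * ℓ * klTorusNorm L (k - k')) ∧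
    (∀ t ∈ Icc (0 : ℝ) 1, ∀ k : TorusSite 2 L, ‖Fx₁₀ t (k + -q) k‖ ≤ 2 * a) ∧
    (∀ t ∈ Icc (0 : ℝ) 1, ∀ k k' : TorusSite 2 L, ‖Fx₁₀ t (k + -q) k - Fx₁₀ t (k' + -q) k'‖ ≤ 4 * ℓ * klTorusNorm L (k - k')) := by
  subst hFx₁₀
  have hn0 : ∀ r : TorusSite 2 L, 0 ≤ klTorusNorm L r := fun r => torusSupNorm_nonneg _
  refine ⟨fun t ht k => (hsup t ht _ _).trans (by linarith), fun t ht k k' => ?_,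
    fun t ht k => (hsup t ht _ _).trans (by linarith), fun t ht k k' => ?_⟩
  · have h := hlip t ht k (k + q) k' (k' + q)
    rw [klTorusNorm_add_sub_add] at h
    have := hn0 (k - k')
    calc ‖Fx₁ t (omega0 M, k) ((omega0 M).rev, k + q) - Fx₁ t (omega0 M, k') ((omega0 M).rev, k' + q)‖
        ≤ ℓ * (klTorusNorm L (k - k') + klTorusNorm L (k - k')) := h
      _ ≤ 4 * ℓ * klTorusNorm L (k - k') := by nlinarith
  · have h := hlip t ht (k + -q) k (k' + -q) k'
    rw [klTorusNorm_add_sub_add] at h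
    have := hn0 (k - k')
    calc ‖Fx₁ t (omega0 M, k + -q) ((omega0 M).rev, k) - Fx₁ t (omega0 M, k' + -q) ((omega0 M).rev, k')‖
        ≤ ℓ * (klTorusNorm L (k - k') + klTorusNorm L (k - k')) := h
      _ ≤ 4 * ℓ * klTorusNorm L (k - k') := by nlinarith

end

end Summit.HubbardSuperconductivity.HubbardSuperconductivity.Theorems.EngineV8
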